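import Summits.Ventures.PercRepro.RankLevelSetLevelSixBasisTail

/-!
# PercRepro — THE LEVEL-`6` BASIS CELL, PART B: THE CELL (p8 g10, S3)

`proofs/SUBCLAIM-S3-p8.md` §3x. The cell `sq27di3` (RankLevelSetLevelSixHeavyCellSq27DI3) with the PAIR COUNT of the
light class and the circuit-based tail replaced by THE BASIS DEVICE (RankLevelSetBasisDeviceB, RankLevelSetLevelSixBasisTail):
* the light rank-`6` sets (closure of at most `5 + ν₁` points, `|B| ≤ d`) number at most `G·C(n, 6)` for any `G` with
  `720·Σ_{i ∈ [6, d]} C(m, i) ≤ G·∏_{k < 6} max(m − flatCap k, 1)` on `6 ≤ m ≤ 5 + ν₁` (`hG`); the heavy ones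
  (`6 + ν₁ ≤ |cl B|`) by the union windows of `sq27di` (`uG`, `uH`);
* the tail `#{r ≤ 5}` by `ncard_eRk_le_five_le_basis`, `#{r = 6}` by the device at the size cap `a = min 39 (6 + d)`
  (`hG'`) plus the heavy window at `a`, and the spanning count as the hypothesis `Sp`.
No circuit count enters. Conclusion `Φ·#U(p, 6) ≤ #Y(p, 6)` for `Φ ≤ 2^{p+6}/D`. Axioms: standard.
-/

open scoped Matroid

namespace PercRepro

namespace ThmN

open Set

variable {α : Type}

set_option maxHeartbeats 800000 in
/-- **THE BASIS CELL**: `Φ·#U(p, 6) ≤ #Y(p, 6)` on the `e`-free core of rank `p` and corank `d` from the heavy windows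
`uG`, `uH` of `sq27di`, the basis-device constants `G` (the light rank-`6` sets of `≤ d` elements) and `G'` (the light
rank-`6` sets of `≤ min 39 (6 + d)` elements), the spanning count `Sp`, and the two numeral inequalities `hpoly`
(`Kn·(G·C(n, 6) + windows(d)) ≤ (Kn − Kd)·2^{d−6}·D`) and `htail`
(`Kn·(tail₅(n) + G'·C(n, 6) + windows(a) + Sp) ≤ Kd·2^n`). -/
theorem c025_core_six_basis_cell (M : Matroid α) [M.Finite] (p d ν₁ j j' uG uH Kn Kd D : ℕ)
    (hD : 0 < D) (Φ : ℚ) (hΦ : Φ ≤ (2 : ℚ) ^ (p + 6) / (D : ℚ)) (hd7 : 7 ≤ d) (_hp7 : 7 ≤ p) (Sp : ℚ)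
    (hsp : ({X : Set α | X ⊆ M.E ∧ M.eRk X = M.eRank}.ncard : ℚ) ≤ Sp)
    (hν7 : 7 ≤ ν₁) (hj : 1 ≤ j) (hj5 : j ≤ 5) (hj' : 1 ≤ j') (hj'4 : j' ≤ 4)
    (hνj : d + cnull (5 - j) + 1 ≤ 2 * ν₁) (hνj' : d + cnull (4 - j') + 1 ≤ 2 * ν₁)
    (huG : 6 + (j + 1) * d ≤ uG + j * ν₁ ∨ (d + 14 + 1 ≤ 2 * ν₁ ∧ min 39 (6 + d) ≤ uG))
    (huH : 5 + (j' + 1) * d ≤ uH + j' * ν₁ ∨ (d + 7 ≤ 2 * ν₁ ∧ min 19 (5 + d) ≤ uH) ∨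
      min 19 (5 + d) + 1 ≤ 5 + ν₁)
    (hK : Kd < Kn) (hKd : 0 < Kd) (G G' : ℚ) (hG0 : 0 ≤ G) (hG'0 : 0 ≤ G')
    (hG : ∀ m, 6 ≤ m → m ≤ 5 + ν₁ → (720 : ℚ) * (∑ i ∈ Finset.Icc 6 d, ((m.choose i : ℕ) : ℚ)) ≤
      G * ((∏ k ∈ Finset.range 6, max (m - flatCap k) 1 : ℕ) : ℚ))
    (hG' : ∀ m, 6 ≤ m → m ≤ 5 + ν₁ →
      (720 : ℚ) * (∑ i ∈ Finset.Icc 6 (min 39 (6 + d)), ((m.choose i : ℕ) : ℚ)) ≤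
        G' * ((∏ k ∈ Finset.range 6, max (m - flatCap k) 1 : ℕ) : ℚ))
    (htail : (Kn : ℚ) * ((1 + ((p + d : ℕ) : ℚ) + (4 / 3 : ℚ) * (((p + d).choose 2 : ℕ) : ℚ) +
        (14 / 5 : ℚ) * (((p + d).choose 3 : ℕ) : ℚ) + (64 / 7 : ℚ) * (((p + d).choose 4 : ℕ) : ℚ) +
        (216355 / 2223 : ℚ) * (((p + d).choose 5 : ℕ) : ℚ)) +
      (G' * (((p + d).choose 6 : ℕ) : ℚ) +
        ((∑ i ∈ Finset.Icc 6 (min 39 (6 + d)), ((Nat.choose uG i : ℕ) : ℚ)) +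
          ((∑ i ∈ Finset.Icc 6 (min 39 (6 + d)), ((Nat.choose uH i : ℕ) : ℚ)) +
            ((p + d : ℕ) : ℚ) * (∑ i ∈ Finset.Icc 5 (min 39 (6 + d) - 1), ((Nat.choose uH i : ℕ) : ℚ))))) +
      Sp) ≤ Kd * 2 ^ (p + d))
    (hR : M.eRank = (p : ℕ∞)) (hn : M.E.ncard = p + d)
    (hfree : ∀ e ∈ M.E, ∃ A ⊆ M.E \ {e}, e ∉ M.closure A ∧ e ∉ M.closure ((M.E \ {e}) \ A))
    (hpoly : (Kn : ℚ) * (G * (((p + d).choose 6 : ℕ) : ℚ) +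
      ((∑ i ∈ Finset.Icc 6 d, ((Nat.choose uG i : ℕ) : ℚ)) +
        ((∑ i ∈ Finset.Icc 6 d, ((Nat.choose uH i : ℕ) : ℚ)) +
          ((p + d : ℕ) : ℚ) * (∑ i ∈ Finset.Icc 5 (d - 1), ((Nat.choose uH i : ℕ) : ℚ))))) ≤
      ((Kn - Kd : ℕ) : ℚ) * 2 ^ (d - 6) * (D : ℚ)) :
    Φ * (Matroid.topCount M p 6 : ℚ) ≤ (Matroid.midCount M p 6 : ℚ) := by
  classical
  have hEcard : M.ground_finite.toFinset.card = p + d := by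
    rw [← Set.ncard_eq_toFinset_card _ M.ground_finite]; exact hn
  have hd : M.E.encard = M.eRank + d := by
    rw [hR, ← M.ground_finite.cast_ncard_eq, hn]
    push_cast; ring
  -- the nullity cap: every `X ⊆ E` has `|X| ≤ r(X) + d`
  have hcap : ∀ X ⊆ M.E, ∀ k : ℕ, M.eRk X ≤ k → X.ncard ≤ k + d := by
    intro X hX k hr
    have h1 := Matroid.encard_le_eRk_add_of_encard_eq hX hd
    have h2 : X.encard ≤ (k : ℕ∞) + d := h1.trans (by gcongr)
    have hfin : X.Finite := M.ground_finite.subset hX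
    rw [← hfin.cast_ncard_eq] at h2; exact_mod_cast h2
  have hflat : ∀ X ⊆ M.E, M.eRk X ≤ 6 → X.ncard ≤ min 39 (6 + d) :=
    fun X hX hr => le_min (ncard_le_thirtynine_of_eRk_le_six_of_free M hfree hX hr) (hcap X hX 6 hr)
  have hflat' : ∀ X ⊆ M.E, M.eRk X ≤ ((6 - 1 : ℕ) : ℕ∞) → X.ncard ≤ min 19 (5 + d) :=
    fun X hX hr => le_min (ncard_le_nineteen_of_eRk_le_five_of_free M hfree hX (by simpa using hr))
      (hcap X hX 5 (by simpa using hr))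
  have hc : ∀ X ⊆ M.E, M.eRk X ≤ ((6 - 2 : ℕ) : ℕ∞) → (X.ncard : ℕ∞) ≤ M.eRk X + cnull 4 :=
    fun X hX hr => nullity_cap_core M hfree 4 (le_refl 4) X hX (by simpa using hr)
  have hc6 : cnull 4 + 1 ≤ ν₁ := by simp [cnull]; omega
  have hcj : ∀ X ⊆ M.E, M.eRk X ≤ ((6 - j - 1 : ℕ) : ℕ∞) → (X.ncard : ℕ∞) ≤ M.eRk X + cnull (5 - j) :=
    fun X hX hr => nullity_cap_core M hfree (5 - j) (by omega) X hX
      (by rwa [show (6 - j - 1 : ℕ) = 5 - j by omega] at hr)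
  have hcj' : ∀ X ⊆ M.E, M.eRk X ≤ ((6 - 1 - j' - 1 : ℕ) : ℕ∞) → (X.ncard : ℕ∞) ≤ M.eRk X + cnull (4 - j') :=
    fun X hX hr => nullity_cap_core M hfree (4 - j') (by omega) X hX
      (by rwa [show (6 - 1 - j' - 1 : ℕ) = 4 - j' by omega] at hr)
  have hUG : (Matroid.UG M 6 ν₁).ncard ≤ uG := by
    rcases huG with huG | ⟨hu1, hu2⟩
    · have := Matroid.ncard_UG_le (M := M) (q := 6) (ν₁ := ν₁) (j := j) (by norm_num) hd hc hc6 hcj hνj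
      omega
    · exact (Matroid.ncard_UG_le_of_unique (M := M) (q := 6) (ν₁ := ν₁) hd (nullity_cap_core_five M hfree) hu1
        (fun X hX hr => hflat X hX (by simpa using hr))).trans hu2
  have hUH : (Matroid.UH M 6 ν₁).ncard ≤ uH := by
    rcases huH with h | ⟨h1, h2⟩ | h
    · have := Matroid.ncard_UH_le (M := M) (q := 6) (ν₁ := ν₁) (j' := j') (by norm_num) hd hc hc6 hcj' hνj'
      omega
    · have hνc : d + cnull 4 + 1 ≤ 2 * ν₁ := by simp [cnull]; omega
      exact (Matroid.ncard_UH_le_of_unique (M := M) (q := 6) hd hc hνc hflat').trans h2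
    · rw [Matroid.UH_eq_empty (M := M) (q := 6) (ν₁ := ν₁) hflat' (by omega)]
      simp
  -- the size-capped heavy count at any cap `c`
  have hHvc : ∀ c : ℕ, ({B : Set α | B ⊆ M.E ∧ M.eRk B = (6 : ℕ) ∧ 6 + ν₁ ≤ (M.closure B).ncard ∧ B.ncard ≤ c}.ncard : ℚ) ≤
      (∑ i ∈ Finset.Icc 6 c, ((Nat.choose uG i : ℕ) : ℚ)) +
        ((∑ i ∈ Finset.Icc 6 c, ((Nat.choose uH i : ℕ) : ℚ)) +
          ((p + d : ℕ) : ℚ) * (∑ i ∈ Finset.Icc 5 (c - 1), ((Nat.choose uH i : ℕ) : ℚ))) := by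
    intro c
    have h1 := Matroid.ncard_heavy_le_cap_window (M := M) 6 ν₁ c
    have h2 : ∑ i ∈ Finset.Icc 6 c, (Matroid.UG M 6 ν₁).ncard.choose i +
        (∑ i ∈ Finset.Icc 6 c, (Matroid.UH M 6 ν₁).ncard.choose i +
          M.E.ncard * ∑ i ∈ Finset.Icc (6 - 1) (c - 1), (Matroid.UH M 6 ν₁).ncard.choose i) ≤
        ∑ i ∈ Finset.Icc 6 c, uG.choose i + (∑ i ∈ Finset.Icc 6 c, uH.choose i +
          (p + d) * ∑ i ∈ Finset.Icc 5 (c - 1), uH.choose i) := by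
      rw [hn, show (6 : ℕ) - 1 = 5 from rfl]
      exact Nat.add_le_add (Finset.sum_le_sum (fun i _ => Nat.choose_le_choose i hUG))
        (Nat.add_le_add (Finset.sum_le_sum (fun i _ => Nat.choose_le_choose i hUH))
          (Nat.mul_le_mul_left _ (Finset.sum_le_sum (fun i _ => Nat.choose_le_choose i hUH))))
    exact_mod_cast h1.trans h2
  -- the flat caps and the two device instances
  have hfcap := flatCap_bound M hfree
  have hf6 : ∀ k : ℕ, k < 6 → ∀ X ⊆ M.E, M.eRk X ≤ (k : ℕ∞) → X.ncard ≤ flatCap k :=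
    fun k hk => hfcap k (by omega)
  have h720 : ((Nat.factorial 6 : ℕ) : ℚ) = 720 := by norm_num [Nat.factorial]
  have hlight := Matroid.ncard_eRk_eq_ncard_le_closure_le_le (M := M) 6 d (5 + ν₁) flatCap hf6 G hG0
    (by intro m h1 h2; rw [h720]; exact hG m h1 h2)
  have hlight6 := Matroid.ncard_eRk_eq_ncard_le_closure_le_le (M := M) 6 (min 39 (6 + d)) (5 + ν₁) flatCap hf6 G' hG'0
    (by intro m h1 h2; rw [h720]; exact hG' m h1 h2)
  rw [hn] at hlight hlight6
  -- (U): `#U ≤ G·C(n, 6) + windows(d)`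
  have hU1 := Matroid.topCount_le_ncard_compl (M := M) hR hd 6
  have hsplit := ncard_eRk_six_le_light_add_heavy M ν₁ d
  set W : ℚ := (∑ i ∈ Finset.Icc 6 d, ((Nat.choose uG i : ℕ) : ℚ)) +
      ((∑ i ∈ Finset.Icc 6 d, ((Nat.choose uH i : ℕ) : ℚ)) +
        ((p + d : ℕ) : ℚ) * (∑ i ∈ Finset.Icc 5 (d - 1), ((Nat.choose uH i : ℕ) : ℚ))) with hW
  set N : ℚ := G * (((p + d).choose 6 : ℕ) : ℚ) + W - (((p + d).choose 6 : ℕ) : ℚ) with hN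
  have hUq : (Matroid.topCount M p 6 : ℚ) ≤ (((p + d).choose 6 : ℕ) : ℚ) + N := by
    have h1 : (Matroid.topCount M p 6 : ℚ) ≤
        ({B : Set α | B ⊆ M.E ∧ M.eRk B = (6 : ℕ) ∧ B.ncard ≤ d}.ncard : ℚ) := by exact_mod_cast hU1
    have h2 : ({B : Set α | B ⊆ M.E ∧ M.eRk B = (6 : ℕ) ∧ B.ncard ≤ d}.ncard : ℚ) ≤
        ({B : Set α | B ⊆ M.E ∧ M.eRk B = (6 : ℕ) ∧ B.ncard ≤ d ∧ (M.closure B).ncard ≤ 5 + ν₁}.ncard : ℚ) +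
        ({B : Set α | B ⊆ M.E ∧ M.eRk B = (6 : ℕ) ∧ 6 + ν₁ ≤ (M.closure B).ncard ∧ B.ncard ≤ d}.ncard : ℚ) := by
      exact_mod_cast hsplit
    have h3 := hHvc d
    linarith [h1, h2, hlight, h3, hN]
  -- (Y)
  have hY := Matroid.two_pow_le_midCount_add (M := M) p 6 hR
  rw [hEcard] at hY
  have hT5 := ncard_eRk_le_five_le_basis M hfree
  rw [hn] at hT5
  have hsp6 := ncard_eRk_le_succ_le M 5
  simp only [show (5 : ℕ) + 1 = 6 from rfl, Nat.cast_ofNat] at hsp6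
  have hsub6 : {X : Set α | X ⊆ M.E ∧ M.eRk X = 6}.ncard ≤
      {B : Set α | B ⊆ M.E ∧ M.eRk B = (6 : ℕ) ∧ B.ncard ≤ min 39 (6 + d)}.ncard := by
    apply ncard_le_ncard
    · intro X hX
      exact ⟨hX.1, by exact_mod_cast hX.2, hflat X hX.1 hX.2.le⟩
    · exact M.ground_finite.finite_subsets.subset (fun X hX => hX.1)
  have hsplit6 := ncard_eRk_six_le_light_add_heavy M ν₁ (min 39 (6 + d))
  have hHv6 := hHvc (min 39 (6 + d))
  have hA3q : ({X : Set α | X ⊆ M.E ∧ M.eRk X ≤ 6}.ncard : ℚ) ≤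
      (1 + ((p + d : ℕ) : ℚ) + (4 / 3 : ℚ) * (((p + d).choose 2 : ℕ) : ℚ) +
        (14 / 5 : ℚ) * (((p + d).choose 3 : ℕ) : ℚ) + (64 / 7 : ℚ) * (((p + d).choose 4 : ℕ) : ℚ) +
        (216355 / 2223 : ℚ) * (((p + d).choose 5 : ℕ) : ℚ)) +
      (G' * (((p + d).choose 6 : ℕ) : ℚ) +
        ((∑ i ∈ Finset.Icc 6 (min 39 (6 + d)), ((Nat.choose uG i : ℕ) : ℚ)) +
          ((∑ i ∈ Finset.Icc 6 (min 39 (6 + d)), ((Nat.choose uH i : ℕ) : ℚ)) +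
            ((p + d : ℕ) : ℚ) * (∑ i ∈ Finset.Icc 5 (min 39 (6 + d) - 1), ((Nat.choose uH i : ℕ) : ℚ))))) := by
    have e1 : ({X : Set α | X ⊆ M.E ∧ M.eRk X ≤ 6}.ncard : ℚ) ≤
        ({X : Set α | X ⊆ M.E ∧ M.eRk X ≤ ((5 : ℕ) : ℕ∞)}.ncard : ℚ) +
          ({X : Set α | X ⊆ M.E ∧ M.eRk X = 6}.ncard : ℚ) := by exact_mod_cast hsp6
    have e2 : ({X : Set α | X ⊆ M.E ∧ M.eRk X = 6}.ncard : ℚ) ≤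
        ({B : Set α | B ⊆ M.E ∧ M.eRk B = (6 : ℕ) ∧ B.ncard ≤ min 39 (6 + d)}.ncard : ℚ) := by exact_mod_cast hsub6
    have e3 : ({B : Set α | B ⊆ M.E ∧ M.eRk B = (6 : ℕ) ∧ B.ncard ≤ min 39 (6 + d)}.ncard : ℚ) ≤
        ({B : Set α | B ⊆ M.E ∧ M.eRk B = (6 : ℕ) ∧ B.ncard ≤ min 39 (6 + d) ∧ (M.closure B).ncard ≤ 5 + ν₁}.ncard : ℚ) +
        ({B : Set α | B ⊆ M.E ∧ M.eRk B = (6 : ℕ) ∧ 6 + ν₁ ≤ (M.closure B).ncard ∧ B.ncard ≤ min 39 (6 + d)}.ncard : ℚ) := by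
      exact_mod_cast hsplit6
    calc ({X : Set α | X ⊆ M.E ∧ M.eRk X ≤ 6}.ncard : ℚ)
        ≤ ({X : Set α | X ⊆ M.E ∧ M.eRk X ≤ ((5 : ℕ) : ℕ∞)}.ncard : ℚ) +
            ({X : Set α | X ⊆ M.E ∧ M.eRk X = 6}.ncard : ℚ) := e1
      _ ≤ (1 + ((p + d : ℕ) : ℚ) + (4 / 3 : ℚ) * (((p + d).choose 2 : ℕ) : ℚ) +
            (14 / 5 : ℚ) * (((p + d).choose 3 : ℕ) : ℚ) + (64 / 7 : ℚ) * (((p + d).choose 4 : ℕ) : ℚ) +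
            (216355 / 2223 : ℚ) * (((p + d).choose 5 : ℕ) : ℚ)) +
          (({B : Set α | B ⊆ M.E ∧ M.eRk B = (6 : ℕ) ∧ B.ncard ≤ min 39 (6 + d) ∧ (M.closure B).ncard ≤ 5 + ν₁}.ncard : ℚ) +
            ({B : Set α | B ⊆ M.E ∧ M.eRk B = (6 : ℕ) ∧ 6 + ν₁ ≤ (M.closure B).ncard ∧ B.ncard ≤ min 39 (6 + d)}.ncard : ℚ)) :=
          add_le_add hT5 (e2.trans e3)
      _ ≤ _ := add_le_add le_rfl (add_le_add hlight6 hHv6)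
  have hKdq : (0 : ℚ) < (Kd : ℚ) := by exact_mod_cast hKd
  have hABq : ((Kn : ℚ) / (Kd : ℚ)) * (({X : Set α | X ⊆ M.E ∧ M.eRk X ≤ 6}.ncard : ℚ) +
      ({X : Set α | X ⊆ M.E ∧ M.eRk X = M.eRank}.ncard : ℚ)) ≤ 2 ^ (p + d) := by
    rw [div_mul_eq_mul_div, div_le_iff₀ hKdq]
    have hKn0 : (0 : ℚ) ≤ (Kn : ℚ) := Nat.cast_nonneg _
    have h1 := mul_le_mul_of_nonneg_left (add_le_add hA3q hsp) hKn0
    have h2 : (Kn : ℚ) * (({X : Set α | X ⊆ M.E ∧ M.eRk X ≤ 6}.ncard : ℚ) +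
        ({X : Set α | X ⊆ M.E ∧ M.eRk X = M.eRank}.ncard : ℚ)) ≤ (Kd : ℚ) * 2 ^ (p + d) := by
      refine h1.trans (le_trans (le_of_eq ?_) htail)
      ring
    linarith [h2]
  -- assemble in `ℚ`
  have hYq : (2 : ℚ) ^ (p + d) ≤ (Matroid.midCount M p 6 : ℚ) +
      ({X : Set α | X ⊆ M.E ∧ M.eRk X ≤ 6}.ncard : ℚ) +
      ({X : Set α | X ⊆ M.E ∧ M.eRk X = M.eRank}.ncard : ℚ) := by exact_mod_cast hY
  have hU0 : (0 : ℚ) ≤ (Matroid.topCount M p 6 : ℚ) := Nat.cast_nonneg _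
  have hd6 : 6 ≤ d := by omega
  have hKq : (0 : ℚ) < (Kn : ℚ) / (Kd : ℚ) := by
    apply div_pos _ hKdq
    exact_mod_cast (by omega : 0 < Kn)
  have hLq : ((Kn - Kd : ℕ) : ℚ) / (Kd : ℚ) + 1 = (Kn : ℚ) / (Kd : ℚ) := by
    rw [Nat.cast_sub (by omega : Kd ≤ Kn), div_add_one hKdq.ne']
    ring
  have hCN : (((p + d).choose 6 : ℕ) : ℚ) + N = G * (((p + d).choose 6 : ℕ) : ℚ) + W := by
    rw [hN]; ring
  have hpoly' : ((Kn : ℚ) / (Kd : ℚ)) * ((((p + d).choose 6 : ℕ) : ℚ) + N) ≤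
      (((Kn - Kd : ℕ) : ℚ) / (Kd : ℚ)) * 2 ^ (d - 6) * (D : ℚ) := by
    rw [hCN, div_mul_eq_mul_div, div_mul_eq_mul_div, div_mul_eq_mul_div]
    exact div_le_div_of_nonneg_right hpoly hKdq.le
  have hDq : (0 : ℚ) < (D : ℚ) := by exact_mod_cast hD
  exact level_arith_KD (p := p) (d := d) (n := p + d) (q := 6) rfl hd6 hKq hLq hDq hΦ hU0 hUq hYq hABq hpoly'

end ThmN

end PercRepro
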